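import Summits.BirchSwinnertonDyer.BirchSwinnertonDyer.Theorems.PrintCf2SplitBadTwoLevelModelsPointed
import Summits.BirchSwinnertonDyer.BirchSwinnertonDyer.Theorems.PrintCf2SplitBadTwoLevelSurjOfClassProNull
import Summits.BirchSwinnertonDyer.BirchSwinnertonDyer.Theorems.PrintCf2SplitBadTwoLocSurjOfLevels
import Summits.BirchSwinnertonDyer.BirchSwinnertonDyer.Theorems.PrintCf2SplitBadTwoNormAtVbarTotallyRamified
import Summits.BirchSwinnertonDyer.BirchSwinnertonDyer.Theorems.PrintCf2SplitBadTwoTwistedLayerField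
import Summits.BirchSwinnertonDyer.BirchSwinnertonDyer.Theorems.PrintCf2SplitBadTwoUpperBaseLiftFrameLayers
import Literature.NumberTheory.GaloisRepresentations.GaloisRepUnramifiedProofs
import HarnessLib

/-!
# Crux `PrintCf2.SplitBadTwoRankOneOfFacts` (stmt-BirchSwinnertonDyer-20368), registered stub (REG₂) `stub_xRegular_two`, S3N-FACTFREE road R2,
# ROAD (b) END-TO-END FOR TRIVIAL COEFFICIENTS: (LSₙ) — Greenberg–Vatsal local surjectivity over EVERY layer `K*_n` of the `ℤ_p`-line
# unramified outside `v̄`, for a discrete module `A ≅ ℚ_p/ℤ_p` with TRIVIAL `Γ_K`-action, UNCONDITIONALLY (Leopoldt-at-`v` = Baker–Brumer is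
# a theorem of the tree): models (B3e′) ∘ class-level (PRO-NULL)_U (B3d p706446 ∘ -w3 g13 p703858) ∘ `v̄`-reading (B5-U, -w3 g14 p707091)
# ∘ level assembly (B3c p706017) ∘ -w4 g12's torsion-exponent reduction (p700951)

Cell `bsd-print-cf2`, WIDTH seat `bsd-line-cf2-p1-w8` g5 (prover-bsd-line-cf2-p1-w8-g5-0); `--supports stmt-BirchSwinnertonDyer-20368`
(helper, Theses-free). HONEST FRAMING: nothing here closes the crux or a registered stub; BSD is not proved by any of this; no summit
statement is proved by this seat. No definition, no named fact, no `sorry`. UNCONDITIONAL.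

WHAT.
* `isUnramifiedAt_coind_of_inertia_le` — `Maps(Γ_K ⧸ U, N)` is unramified at `w` when the chosen inertia group `I_w` lies in the normal open
  `U` and acts trivially on `N` (criterion `GaloisRep.isUnramifiedAt_iff_toLocal`).
* **`locSurj_torsionExponent_trivial`** — `K` imaginary quadratic, `p = v v̄` (`hall`), `U = Gal(K̄/F)` open normal with `F/K` finite abelian,
  `I_w ≤ U` for every `w ∤ p` (`hIU`), `v̄` «totally ramified» in `F` in the sense `Γ_K = I_𝔓 · U` for every `𝔓 ∣ v̄` (`htot`), `A` a discrete
  `Γ_K`-module with TRIVIAL action, open stabilisers and `A ≃+ ℚ_p/ℤ_p`: for every exponent `k`, (SUR_U) holds for every `p^k`-torsion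
  target family — VERBATIM the `hLSk k` body of -w4 g12's `UpperBaseLift.locSurj_of_forall_torsionExponent` at `U`.
* **`locSurj_layers_trivial`** — on the `ℤ_p`-line `κ` unramified outside `v̄` (`p ∤ h_K`): (LSₙ) for `A` at EVERY layer `U = κ.layerSubgroup n`
  — VERBATIM the `hLSn n` body of `UpperBaseLift.locSurj_of_layers` (p700059) / `XRegPinned.xRegular_char_of_layers` (p702770), all `n`
  (`n₁ = 0`).
USE: for the trivial sign (`θ = 1` as a framed character: `charModule ∅ 1 ≃+ ℚ_p/ℤ_p` by `charModuleEquiv`, trivial action) this is the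
(LSₙ,₂) input of -w2 g14's `XRegPinned.stub_xRegular_two_of_locSurjLayers` (p704095) at that `θ`; the sign-twisted `θ` go through B3d′
(p706910) and the twisted `v̄`-reading (in flight, -w3 g14 and -w4 g14). presearch: GV2000 §2 Prop. 2.1; Greenberg LNM 1716 §4 Props. 4.13–4.15;
de Shalit III.2.3 (Baker–Brumer ⟹ Leopoldt) — assembly of tree theorems, no new fact. beyond-print theorem: no.

References: [GreenbergVatsal2000] §2 Prop. 2.1; [GreenbergLNM1716] §4 Props. 4.13–4.15; [deShalit1987] III.2.3; [MilneADT2006] I Thm. 4.10 (b).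
-/

noncomputable section

open scoped Classical ContRepresentation

set_option linter.dupNamespace false
set_option autoImplicit false

open CategoryTheory NumberField IsDedekindDomain Field ValuativeRel
open Literature.NumberTheory.EllipticCurves Literature.NumberTheory.EllipticCurves.GreenbergSelmer
open Literature.NumberTheory.EllipticCurves.GreenbergVatsal2000
open Literature.NumberTheory.GaloisRepresentations Literature.NumberTheory.GaloisRepresentations.LocalWeilDatum
open Literature.NumberTheory.GaloisRepresentations.DiscreteGaloisModule (SelmerStructure mu MuCarrier TateDual tateDual
  coindTateDualMor coindTateDualHom)
open Literature.NumberTheory.GaloisCohomology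
open Literature.NumberTheory.IwasawaTheory
open Summit.BirchSwinnertonDyer.Rank1Residual.X11b.LocBridge

namespace Summit.BirchSwinnertonDyer.BirchSwinnertonDyer.Theorems.PrintCf2.LayerShapiro

variable {K : Type} [Field K] [NumberField K] {p : ℕ} [Fact p.Prime]

/-! ## §1. Unramifiedness of the coinduced module -/

/-- **`Maps(Γ_K ⧸ U, N)` is unramified at `w`** when `I_w ≤ U` (`U` normal open) and `I_w` acts trivially on `N`: on `Γ_K ⧸ U` the inertia acts
trivially (`σ⁻¹ • gU = gU` for `σ ∈ U ⊴ Γ_K`), on the values by hypothesis; `GaloisRep.isUnramifiedAt_iff_toLocal` reduces to the chosen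
inertia group `I_w = θ_w(I(K_w))`. [cite: SerreLocalFields1979, VII §5] [cite: NeukirchANT1999, Ch. II §9 Prop. (9.6)] -/
theorem isUnramifiedAt_coind_of_inertia_le (U : Subgroup (absoluteGaloisGroup K)) [U.Normal]
    (hU : IsOpen (U : Set (absoluteGaloisGroup K))) [Fintype (absoluteGaloisGroup K ⧸ U)]
    {N : Type} [AddCommGroup N] [DistribMulAction (absoluteGaloisGroup K) N] [TopologicalSpace N] [DiscreteTopology N]
    (hN : ∀ m : N, IsOpen {σ : absoluteGaloisGroup K | σ • m = m}) (w : HeightOneSpectrum (𝓞 K))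
    (hIU : GreenbergSelmer.inertia w ≤ U) (hIN : ∀ σ ∈ GreenbergSelmer.inertia w, ∀ x : N, σ • x = x) :
    GaloisRep.IsUnramifiedAt w ((ofSMul N hN).coind U hU) := by
  refine (GaloisRep.isUnramifiedAt_iff_toLocal_holds w ((ofSMul N hN).coind U hU)).2 fun t ht ↦ ?_
  have hσI : absGaloisRestrict K (w.adicCompletion K) t ∈ GreenbergSelmer.inertia w := Subgroup.mem_map_of_mem _ ht
  have hσU : absGaloisRestrict K (w.adicCompletion K) t ∈ U := hIU hσI
  have key : ∀ φ : absoluteGaloisGroup K ⧸ U → N,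
      (ofSMul N hN).coind U hU (absGaloisRestrict K (w.adicCompletion K) t) φ = φ := by
    intro φ
    funext y
    rw [DiscreteGaloisModule.coind_apply_apply, ofSMul_apply_apply, hIN _ hσI]
    congr 1
    induction y using QuotientGroup.induction_on with
    | H g =>
      rw [MulAction.Quotient.smul_coe, QuotientGroup.eq, smul_eq_mul, mul_inv_rev, inv_inv]
      have h := Subgroup.Normal.conj_mem' (inferInstance : U.Normal) _ hσU g
      simpa [mul_assoc] using h
  rw [GaloisRep.toLocal_apply]
  exact LinearMap.ext key

/-! ## §2. (SUR_U) for trivial `A ≅ ℚ_p/ℤ_p` over `U = Gal(K̄/F)`, every exponent -/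

/-- **(SUR_U) FOR EVERY `p^k`-TORSION TARGET FAMILY, TRIVIAL COEFFICIENTS `A ≅ ℚ_p/ℤ_p`, over `U = Gal(K̄/F)`** (`F/K` finite abelian,
`K` imaginary quadratic, `p = v v̄`, `I_w ≤ U` off `p`, `Γ_K = I_𝔓 · U` above `v̄`) — VERBATIM the `hLSk k` body of
`UpperBaseLift.locSurj_of_forall_torsionExponent`; UNCONDITIONAL. [cite: GreenbergVatsal2000, §2 Prop. 2.1] [cite: deShalit1987, III.2.3]
[cite: MilneADT2006, Ch. I, Thm. 4.10 (b)] -/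
theorem locSurj_torsionExponent_trivial (hK : IsImaginaryQuadratic K) {v vbar : HeightOneSpectrum (𝓞 K)}
    (hv : ((p : ℕ) : 𝓞 K) ∈ v.asIdeal) (hvbar : ((p : ℕ) : 𝓞 K) ∈ vbar.asIdeal) (hne : vbar ≠ v)
    (hall : ∀ w : HeightOneSpectrum (𝓞 K), ((p : ℕ) : 𝓞 K) ∈ w.asIdeal → w = v ∨ w = vbar)
    (U : Subgroup (absoluteGaloisGroup K)) [U.Normal] (hUopen : IsOpen (U : Set (absoluteGaloisGroup K)))
    [Fintype (absoluteGaloisGroup K ⧸ U)]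
    (F : IntermediateField K (AlgebraicClosure K)) [FiniteDimensional K F] [IsAbelianGalois K F] [NumberField F]
    (hUF : galFixing K F = U)
    (hIU : ∀ w : HeightOneSpectrum (𝓞 K), ((p : ℕ) : 𝓞 K) ∉ w.asIdeal → GreenbergSelmer.inertia w ≤ U)
    (htot : ∀ 𝔓 ∈ vbar.primesAbove, ∀ σ : absoluteGaloisGroup K, ∃ τ ∈ 𝔓.inertia (absoluteGaloisGroup K), τ⁻¹ * σ ∈ U)
    {A : Type} [AddCommGroup A] [DistribMulAction (absoluteGaloisGroup K) A] [TopologicalSpace A] [DiscreteTopology A]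
    (hA : ∀ a : A, IsOpen {σ : absoluteGaloisGroup K | σ • a = a}) (hA1 : ∀ (σ : absoluteGaloisGroup K) (a : A), σ • a = a)
    (e : A ≃+ QpModZp p) (k : ℕ) :
    ∀ (T : Finset (HeightOneSpectrum (𝓞 K))), (∀ w ∈ T, ((p : ℕ) : 𝓞 K) ∉ w.asIdeal ∨ w = vbar) →
      ∀ τ : (w : HeightOneSpectrum (𝓞 K)) →
        DoubleCoset.Quotient (decomp (K := K) w : Set (absoluteGaloisGroup K)) (U : Set (absoluteGaloisGroup K)) →
          subgroupH1 (decompIn U w) A,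
      (∀ w ∈ T, ∀ q, p ^ k • τ w q = 0) →
      ∃ z : subgroupH1 U A,
        (∀ w ∈ T, ∀ q : DoubleCoset.Quotient (decomp (K := K) w : Set (absoluteGaloisGroup K)) (U : Set (absoluteGaloisGroup K)),
          resOfLe A (inertiaIn_le_decompIn U w)
            (resH1Hom (decompInToH U w) (AddMonoidHom.id A) (fun _ _ ↦ rfl) (conjH1 U A q.out z) - τ w q) = 0) ∧
        (∀ w : HeightOneSpectrum (𝓞 K), w ∉ T → (((p : ℕ) : 𝓞 K) ∉ w.asIdeal ∨ w = vbar) →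
          ∀ σ : absoluteGaloisGroup K, conjH1 U A σ z ∈ GreenbergVatsal2000.unramifiedKer U A w) := by
  subst hUF
  -- the level `M` of the class-level (PRO-NULL)_U, through B3d
  obtain ⟨M, hkM, hM⟩ := exists_level_levelSurj_of_classProNull (p := p) hK hv hvbar hne hall F hUopen k
  -- the models, for the trivial sign `ε = 1`
  have hε : IsOpen ((1 : absoluteGaloisGroup K →* ℤˣ).ker : Set (absoluteGaloisGroup K)) := by
    rw [MonoidHom.ker_one]; exact isOpen_univ
  have hAε : ∀ (σ : absoluteGaloisGroup K) (a : A), σ • a = (((1 : absoluteGaloisGroup K →* ℤˣ) σ : ℤˣ) : ℤ) • a := fun σ a ↦ by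
    rw [hA1, MonoidHom.one_apply, Units.val_one, one_zsmul]
  obtain ⟨N₀, N, N₀', N', _, _, _, _, _, _, _, _, _, _, _, _, _, _, _, _, _, _, hN₀, hN, hN₀', hN', j, ι₀, ι, B, B₀, jD, ι', ι₀',
    hN₀ε, hNε, hMN, hj, hι₀eq, hι₀inj, hrange, hιeq, hcomp, hdiv, hMN', hB, hBbij, hB₀, hjD, hBj, hι'inj, hι'eq, hι₀'inj, hι₀'eq,
    hι₀'surj, htι, m₀, hι'B⟩ :=
    exists_signLevelModels_pointed (p := p) (1 : absoluteGaloisGroup K →* ℤˣ) hε hAε e k M hkM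
  -- trivial sign: untwisted data
  have hNtriv : ∀ (σ : absoluteGaloisGroup K) (x : N), σ • x = x := fun σ x ↦ by
    rw [hNε, MonoidHom.one_apply, Units.val_one, one_zsmul]
  have hι'₁ : ∀ (g : absoluteGaloisGroup K) (x : N'), Additive.toMul (ι' (g • x)) = g • Additive.toMul (ι' x) := fun g x ↦ by
    rw [hι'eq, MonoidHom.one_apply, Units.val_one, zpow_one]
  have hι₀'₁ : ∀ (g : absoluteGaloisGroup K) (x : N₀'), Additive.toMul (ι₀' (g • x)) = g • Additive.toMul (ι₀' x) := fun g x ↦ by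
    rw [hι₀'eq, MonoidHom.one_apply, Units.val_one, zpow_one]
  have hUnr : ∀ w : HeightOneSpectrum (𝓞 K), ((p : ℕ) : 𝓞 K) ∉ w.asIdeal →
      GaloisRep.IsUnramifiedAt w ((ofSMul N hN).coind (galFixing K F) hUopen) := fun w hw ↦
    isUnramifiedAt_coind_of_inertia_le (galFixing K F) hUopen hN w (hIU w hw) fun σ _ x ↦ hNtriv σ x
  have hm₀ : ∀ σ : absoluteGaloisGroup K, ofSMul N hN σ m₀ = m₀ := fun σ ↦ hNtriv σ m₀
  have hn0 : p ^ M • m₀ = 0 := hMN m₀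
  -- B3c over B3d, with B5-U at `v̄`
  refine locSurj_torsionExponent_of_levelSurj (galFixing K F) hA vbar k hdiv ι₀ hι₀eq hι₀inj hrange ι hιeq j hj hcomp ?_
  exact hM hN₀ hN hN₀' hN' hMN hMN' j hj B hB hBbij B₀ hB₀ jD hjD hBj ι' hι'inj hι'₁ ι₀' hι₀'inj hι₀'₁ hι₀'surj htι hUnr
    (fun hs hs1 φ hφ β hβ b hb w' ↦ NormAtVbar.dvd_log_valuation_of_dualShapiro_mem_of_totallyRamified (ofSMul N hN) hN' B hB
      F hUopen hm₀ hn0 ι' hι'B vbar htot hs hs1 φ hφ β hβ b hb w')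

/-! ## §3. (LSₙ) for trivial `A ≅ ℚ_p/ℤ_p` on every layer of the line unramified outside `v̄` -/

/-- **(LSₙ) FOR TRIVIAL `A ≅ ℚ_p/ℤ_p` AT EVERY LAYER `U = κ.layerSubgroup n` OF THE `ℤ_p`-LINE UNRAMIFIED OUTSIDE `v̄`** (`K` imaginary
quadratic, `p ∤ h_K`, `p = v v̄`) — VERBATIM the `hLSn n` body of `UpperBaseLift.locSurj_of_layers` / `XRegPinned.xRegular_char_of_layers`,
for ALL `n`; UNCONDITIONAL. Inputs: `locSurj_torsionExponent_trivial` at `F′` with `Gal(K̄/F′) = κ.layerSubgroup n` (-w4 g14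
`exists_twistedLayerField` at `ε = 1`), `I_w ≤ ker κ ≤ κ.layerSubgroup n` (`κ` unramified outside `v̄`), total ramification above `v̄`
(-w3 g14 `forall_exists_inertia_mul_mem_galFixing_layer`), -w4 g12's `locSurj_layerSubgroup_of_forall_torsionExponent` with «no relevant
place splits completely» (`not_decomp_le_kerSubgroup_of_isUnramifiedOutside_or_eq`). [cite: GreenbergVatsal2000, §2 Prop. 2.1]
[cite: GreenbergLNM1716, §4 Props. 4.13–4.15] [cite: deShalit1987, III.2.3] -/
theorem locSurj_layers_trivial (hK : IsImaginaryQuadratic K) (hh : ¬ p ∣ NumberField.classNumber K)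
    {v vbar : HeightOneSpectrum (𝓞 K)}
    (hv : ((p : ℕ) : 𝓞 K) ∈ v.asIdeal) (hvbar : ((p : ℕ) : 𝓞 K) ∈ vbar.asIdeal) (hne : vbar ≠ v)
    (hall : ∀ w : HeightOneSpectrum (𝓞 K), ((p : ℕ) : 𝓞 K) ∈ w.asIdeal → w = v ∨ w = vbar)
    (κ : ZpExtension K p) (hκ : κ.IsUnramifiedOutside vbar)
    {A : Type} [AddCommGroup A] [DistribMulAction (absoluteGaloisGroup K) A] [TopologicalSpace A] [DiscreteTopology A]
    (hA : ∀ a : A, IsOpen {σ : absoluteGaloisGroup K | σ • a = a}) (hA1 : ∀ (σ : absoluteGaloisGroup K) (a : A), σ • a = a)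
    (e : A ≃+ QpModZp p) (n : ℕ) [Fintype (absoluteGaloisGroup K ⧸ κ.layerSubgroup n)] :
    ∀ (T : Finset (HeightOneSpectrum (𝓞 K))), (∀ w ∈ T, ((p : ℕ) : 𝓞 K) ∉ w.asIdeal ∨ w = vbar) →
      ∀ τ : (w : HeightOneSpectrum (𝓞 K)) →
        DoubleCoset.Quotient (decomp (K := K) w : Set (absoluteGaloisGroup K)) (κ.layerSubgroup n : Set (absoluteGaloisGroup K)) →
          subgroupH1 (decompIn (κ.layerSubgroup n) w) A,
      ∃ z : subgroupH1 (κ.layerSubgroup n) A,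
        (∀ w ∈ T, ∀ q : DoubleCoset.Quotient (decomp (K := K) w : Set (absoluteGaloisGroup K))
            (κ.layerSubgroup n : Set (absoluteGaloisGroup K)),
          resOfLe A (inertiaIn_le_decompIn (κ.layerSubgroup n) w)
            (resH1Hom (decompInToH (κ.layerSubgroup n) w) (AddMonoidHom.id A) (fun _ _ ↦ rfl)
              (conjH1 (κ.layerSubgroup n) A q.out z) - τ w q) = 0) ∧
        (∀ w : HeightOneSpectrum (𝓞 K), w ∉ T → (((p : ℕ) : 𝓞 K) ∉ w.asIdeal ∨ w = vbar) →
          ∀ σ : absoluteGaloisGroup K, conjH1 (κ.layerSubgroup n) A σ z ∈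
            GreenbergVatsal2000.unramifiedKer (κ.layerSubgroup n) A w) := by
  -- the layer field with all its instances
  have hε : IsOpen ((1 : absoluteGaloisGroup K →* ℤˣ).ker : Set (absoluteGaloisGroup K)) := by
    rw [MonoidHom.ker_one]; exact isOpen_univ
  obtain ⟨F', hF'U, -, hfd, hab, hnf, -⟩ := KummerUDict.exists_twistedLayerField κ n (1 : absoluteGaloisGroup K →* ℤˣ) hε
  haveI := hfd; haveI := hab; haveI := hnf
  have hUF : galFixing K F' = κ.layerSubgroup n := by rw [hF'U, MonoidHom.ker_one, inf_top_eq]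
  -- torsion, non-splitting, inertia, total ramification
  have htor : ∀ a : A, ∃ k : ℕ, p ^ k • a = 0 := fun a ↦ by
    obtain ⟨k, hk⟩ := QpModZp.exists_pow_nsmul_eq_zero (e a)
    exact ⟨k, e.injective (by rw [map_nsmul, hk, map_zero])⟩
  have hIU : ∀ w : HeightOneSpectrum (𝓞 K), ((p : ℕ) : 𝓞 K) ∉ w.asIdeal → GreenbergSelmer.inertia w ≤ κ.layerSubgroup n :=
    fun w hw ↦ (hκ.inertia_le fun h ↦ hw (by rw [h]; exact hvbar)).trans (κ.kerSubgroup_le_layerSubgroup n)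
  have htot : ∀ 𝔓 ∈ vbar.primesAbove, ∀ σ : absoluteGaloisGroup K,
      ∃ τ ∈ 𝔓.inertia (absoluteGaloisGroup K), τ⁻¹ * σ ∈ κ.layerSubgroup n := fun 𝔓 h𝔓 σ ↦ by
    obtain ⟨τ, hτ, hτσ⟩ := NormAtVbar.forall_exists_inertia_mul_mem_galFixing_layer hK hh hκ n 𝔓 h𝔓 σ
    rw [Literature.NumberTheory.GaloisCohomology.galFixing_layer K κ n] at hτσ
    exact ⟨τ, hτ, hτσ⟩
  exact UpperBaseLift.locSurj_layerSubgroup_of_forall_torsionExponent (M := A) κ n htor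
    (UpperBaseLift.not_decomp_le_kerSubgroup_of_isUnramifiedOutside_or_eq hK hv hvbar hne κ hκ) fun k ↦
      locSurj_torsionExponent_trivial hK hv hvbar hne hall (κ.layerSubgroup n) (κ.isOpen_layerSubgroup n) F' hUF hIU htot hA hA1 e k

end Summit.BirchSwinnertonDyer.BirchSwinnertonDyer.Theorems.PrintCf2.LayerShapiro

end
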